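/-
Copyright (c) 2026 the pub-hodgecm-mathlib formalisation cell (harness21).  Prover seat hodgecm-mathlib-K2Liu-p13 (g3), Track B «K2-LIT»,
#184♮ = hLiu418 = `stmt-HodgeConjecture-24832`; ROAD Φ (RULING «M-156n»), consumer sheet fa2b1e3a29709f09 row G6-fin, clause (v) of the big-cell package —
letter `K2LiuIntertwiningDeltaEquivariance`, part (b) (K2E5-plan (g7) co-deal 2026-09-04T14:22:38Z (C) (F4); LEAD F0P6-plan (g14) BATCH #30 ∕ #32 (2));
census `K2/K2Liu-p13/g3/CENSUS-G6fin-Phi8FacePackaging.K2Liu-p13-g3.md` 065e2d080ef468d9 (F4).  THEOREMS ONLY (no `def`, no `instance`, no named-fact hypothesis,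
no `sorry`); the modulus of `Ad(P_Δ(𝔸))` on `N_Δ(𝔸)`, the Levi homomorphism and the Weyl-conjugate character law are taken BY VALUE.
-/
import Summits.HodgeConjecture.HodgeConjecture.Theorems.K2LiuIntertwiningDeltaLeviLaw
import HarnessLib

/-!
# Crux `HLiu418`, ROAD Φ, organ Φ8 (sheet row G6-fin): THE GLOBAL INTERTWINING PROPERTY `M(s) : I(s, χ) → I(−s, χ′)` —
# `h ↦ M f (h) = ∫_{N_Δ(𝔸)} f(w_Δ u h) du` IS A SIEGEL SECTION OF `I(−s, χ′)`, from the Levi law and two scalar letters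

Cell `hodgecm-mathlib`, crux item hLiu418 = `stmt-HodgeConjecture-24832` (helper lane, count-neutral).  GENERIC `n`, doubled frame `H(𝔸) = HA L e dV hdV dW hdW`.
★ Part (a) `K2LiuIntertwiningDeltaLeviLaw.intertwiningDelta_siegel_mul` gives, for `p ∈ P_Δ(𝔸)` with `Δ`-block `g = p|_Δ` and the modulus `θ(p)` of
`u ↦ p⁻¹ u p` on `N_Δ(𝔸)` BY VALUE, `M f (p h) = θ(p) · δ_{χ,s}(w_Δ (Λ g) w_Δ) · M f (h)`.  With the two SCALAR LETTERS (BY VALUE, to be discharged by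
pure algebra ∕ Haar theory in their own files):
* (MOD) `θ(p) = |det_Δ p|_𝔸^{n} = modDelta(p)^{2n}` — the module of `Ad(p)` on `N_Δ(𝔸) ≅ Herm_n(𝔸_L)` (local twin ★ `map_conj_unipDeltaLocal_eq_smul`; central ray
  ★ `map_conj_centralRay_eq_smul`);
* (WCHAR) `δ_{χ,s}(w_Δ (Λ g) w_Δ) = χ′(det_Δ (Λ g)) · modDelta(Λ g)^{−(2s+n)}` — the Weyl element swaps the Levi blocks (★ `blk_weylDelta_mul_mul_weylDelta_of_blk_eq_levi`:
  `w_Δ m(g, g♯) w_Δ = m(g♯, g)`, `g♯ = T⁻¹ (c g)⁻ᵀ T`), so `det_Δ(w_Δ Λg w_Δ) = c(det g)⁻¹`, `|·|` inverts and `χ` becomes `χ′ = (χ ∘ c)⁻¹` (local twin ★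
  `chiDet_weylDelta_conj` ∕ `absDetDelta_weylDelta_conj`);
this file proves **`isSiegelDeltaSection_intertwiningDelta`**: `M f ∈ I(−s, χ′)`, i.e. `M f (p h) = χ′(det_Δ p)·modDelta(p)^{2(−s)+n} · M f (h)` for all
`p ∈ P_Δ(𝔸)` (`p = Λ g · n₀`, `n₀ ∈ N_Δ(𝔸)` by ★ `exists_levi_mul_unip`; `χ′(det_Δ ·)` and `modDelta` are trivial on `N_Δ(𝔸)`), and the FAMILY form
**`intertwiningDelta_family_equivariant`** = the binder `heqv` of ★ `K2LiuBigCellGrowthOfEquivariance.growth_of_equivariance` ∕ `growth_of_equivariance_of_pointRepr`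
with `ω s p := χ′(det_Δ p) · (modDelta p : ℂ)^(n − 2s)`, whose bound `hω` is ★ `K2LiuModDeltaHeightComparison.exists_character_bound` (`κ = n`, `‖χ′(det_Δ p)‖ = 1`
for unitary `χ′`).
Sources: [MoeglinWaldspurger1995, II.1.6]; [HarrisKudlaSweet1996, §1 (1.11)–(1.15), §6 (6.14) (`M(s) : I_n(s, χ) → I_n(−s, (χ ∘ c)⁻¹)`)]; [Casselman1980, §3];
[KudlaSweet1997, §1].
HONEST LABEL.  Helper lemmas, count-neutral; `HC_CM` is proved only modulo the 7 printed citations (2 remaining named inputs: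
hLiu418 = `stmt-HodgeConjecture-24832`, h413 = `stmt-HodgeConjecture-24833`) until rung 0 closes.
-/

set_option autoImplicit false
set_option linter.dupNamespace false -- the mandated namespace repeats `HodgeConjecture.HodgeConjecture`

noncomputable section

open scoped Matrix NNReal ENNReal
open NumberField IsDedekindDomain MeasureTheory MeasureTheory.Measure

namespace Summit.HodgeConjecture.HodgeConjecture.Cruxes.HLiu418.K2LiuIntertwiningDeltaEquivariance

open Literature.NumberTheory.GelbartRogawski1991.AdaptedBlocks
open Literature.NumberTheory.Automorphic Literature.NumberTheory.Automorphic.UnitaryGroup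
open Literature.NumberTheory.GelbartRogawski1991 Literature.NumberTheory.GelbartRogawski1991.GRConstruction
open Literature.NumberTheory.K2Lit.SiegelDoubled Literature.NumberTheory.GaloisRepresentations
open UnitaryDualPair
open Summit.HodgeConjecture.HodgeConjecture.Cruxes.HLiu418.K2LiuSiegelRationalLeviDecomposition
open Summit.HodgeConjecture.HodgeConjecture.Cruxes.HLiu418.K2LiuSiegelLeviConjUnipDeltaChar (conj_mem_unipDelta)
open Summit.HodgeConjecture.HodgeConjecture.Cruxes.HLiu418.K2LiuIntertwiningDeltaLeviLaw

variable (L : Type) [Field L] [NumberField L] [IsCMField L]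
variable {N M n : ℕ} (e : Fin N × Fin M ≃ Fin n)
  (dV : Fin N → L) (hdV : ∀ i, IsCMField.complexConj L (dV i) = dV i)
  (dW : Fin M → L) (hdW : ∀ i, IsCMField.complexConj L (dW i) = dW i)

variable (Λ : GL (Fin n) (AdeleRing (𝓞 L) L) →* HA L e dV hdV dW hdW)
  (hΛ : ∀ g : GL (Fin n) (AdeleRing (𝓞 L) L), blk L e dV hdV dW hdW (Λ g) =
    cayR (AdeleRing (𝓞 L) L) (Fin n) * Matrix.fromBlocks (g : Matrix (Fin n) (Fin n) (AdeleRing (𝓞 L) L)) 0 0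
      (((gramR L e dV hdV dW hdW).map ((algebraMap L (AdeleRing (𝓞 L) L)).comp (algebraMap (Fp L) L)))⁻¹ *
        (((g⁻¹ : GL (Fin n) (AdeleRing (𝓞 L) L)) : Matrix (Fin n) (Fin n) (AdeleRing (𝓞 L) L)).map
          (conjAdele (Fp L) L (IsCMField.complexConj L)))ᵀ *
        (gramR L e dV hdV dW hdW).map ((algebraMap L (AdeleRing (𝓞 L) L)).comp (algebraMap (Fp L) L))) *
      cayRinv (AdeleRing (𝓞 L) L) (Fin n))

/-! ## §1 Scalar bookkeeping -/

/-- `x^{2n} · x^{−(2s+n)} = x^{2(−s)+n}` for a real `x > 0` (complex powers). [folklore] -/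
theorem ofReal_pow_mul_cpow_neg {x : ℝ} (hx : 0 < x) (s : ℂ) (k : ℕ) :
    ((x ^ (2 * k) : ℝ) : ℂ) * ((x : ℂ) ^ (-(2 * s + (k : ℂ)))) = (x : ℂ) ^ (2 * (-s) + (k : ℂ)) := by
  have hx0 : (x : ℂ) ≠ 0 := Complex.ofReal_ne_zero.2 hx.ne'
  rw [Complex.ofReal_pow, ← Complex.cpow_natCast, ← Complex.cpow_add _ _ hx0]
  congr 1
  push_cast
  ring

include hΛ in
/-- the character of `I(−s, χ′)` on a decomposed element: `δ_{χ′,−s}(Λ g · n₀) = χ′(det_Δ Λg) · modDelta(Λ g)^{2(−s)+n}` (`n₀ ∈ N_Δ(𝔸)` contributes `1`).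
[cite: HarrisKudlaSweet1996, §1 (1.11)–(1.15)] -/
theorem siegelDeltaCharacter_levi_mul_unip (χ' : HeckeCharacter L) (s : ℂ) (g : GL (Fin n) (AdeleRing (𝓞 L) L)) {n₀ : HA L e dV hdV dW hdW}
    (hn₀ : n₀ ∈ unipDelta L e dV hdV dW hdW) :
    siegelDeltaCharacter L e dV hdV dW hdW χ' (-s) (Λ g * n₀) =
      ((chiDet L e dV hdV dW hdW χ' (Λ g) : ℂˣ) : ℂ) * ((modDelta L e dV hdV dW hdW (Λ g) : ℂ) ^ (2 * (-s) + (n : ℂ))) := by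
  rw [siegelDeltaCharacter_mul L e dV hdV dW hdW χ' (-s) (isSiegelDelta_levi_apply L e dV hdV dW hdW Λ hΛ g) (isSiegelDelta_of_mem_unipDelta L e dV hdV dW hdW hn₀),
    siegelDeltaCharacter_eq_one_of_mem_unipDelta L e dV hdV dW hdW χ' (-s) hn₀, mul_one]
  rfl

/-! ## §2 `M f ∈ I(−s, χ′)` from the Levi law and the two scalar letters -/

include hΛ in
/-- **THE GLOBAL INTERTWINING PROPERTY `M(s) : I(s, χ) → I(−s, χ′)`.**  Let `νN` be a left-invariant measure on `N_Δ(𝔸)` satisfying the MODULUS LETTER (MOD)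
`(u ↦ p⁻¹ u p)_* νN = modDelta(p)^{2n} • νN` for every `p ∈ P_Δ(𝔸)`, let `Λ` be the Levi homomorphism (`hΛ`), and let `χ, χ′` satisfy the WEYL-CHARACTER LETTER
(WCHAR) `δ_{χ,s}(w_Δ (Λ g) w_Δ) = χ′(det_Δ Λg) · modDelta(Λ g)^{−(2s+n)}` for every `g ∈ GL_n(𝔸_L)` (`χ′ = (χ ∘ c)⁻¹`).  Then for every Siegel section `f ∈ I(s, χ)`
the intertwining integral `M f = intertwiningDelta νN f` is a Siegel section of `I(−s, χ′)`:
`M f (p h) = χ′(det_Δ p) · modDelta(p)^{2(−s)+n} · M f (h)` for all `p ∈ P_Δ(𝔸)`, `h ∈ H(𝔸)`.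
[cite: MoeglinWaldspurger1995, II.1.6] [cite: HarrisKudlaSweet1996, §1 (1.15), §6 (6.14)] [cite: Casselman1980, §3] -/
theorem isSiegelDeltaSection_intertwiningDelta (hdV0 : ∀ i, dV i ≠ 0) (hdW0 : ∀ i, dW i ≠ 0)
    [MeasurableSpace (unipDelta L e dV hdV dW hdW)] [BorelSpace (unipDelta L e dV hdV dW hdW)]
    (νN : Measure (unipDelta L e dV hdV dW hdW)) [νN.IsMulLeftInvariant]
    (hmod : ∀ (p : HA L e dV hdV dW hdW) (hp : IsSiegelDelta L e dV hdV dW hdW p),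
      Measure.map (fun u : unipDelta L e dV hdV dW hdW =>
        (⟨p⁻¹ * (u : HA L e dV hdV dW hdW) * p, conj_mem_unipDelta L e dV hdV dW hdW hp u.2⟩ : unipDelta L e dV hdV dW hdW)) νN =
        ENNReal.ofReal (modDelta L e dV hdV dW hdW p ^ (2 * n)) • νN)
    (χ χ' : HeckeCharacter L) (s : ℂ)
    (hwchar : ∀ g : GL (Fin n) (AdeleRing (𝓞 L) L),
      siegelDeltaCharacter L e dV hdV dW hdW χ s (weylDelta L e dV hdV dW hdW * Λ g * weylDelta L e dV hdV dW hdW) =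
        ((chiDet L e dV hdV dW hdW χ' (Λ g) : ℂˣ) : ℂ) * ((modDelta L e dV hdV dW hdW (Λ g) : ℂ) ^ (-(2 * s + (n : ℂ)))))
    {f : HA L e dV hdV dW hdW → ℂ} (hf : IsSiegelDeltaSection L e dV hdV dW hdW χ s f) :
    IsSiegelDeltaSection L e dV hdV dW hdW χ' (-s) (intertwiningDelta L e dV hdV dW hdW νN f) := by
  intro p hp h
  obtain ⟨g, n₀, hg, hn₀, hpm⟩ := exists_levi_mul_unip L e dV hdV dW hdW Λ hΛ hdV0 hdW0 hp
  have hlaw := intertwiningDelta_siegel_mul L e dV hdV dW hdW Λ hΛ hdV0 hdW0 νN hp hg (ENNReal.ofReal (modDelta L e dV hdV dW hdW p ^ (2 * n)))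
    (hmod p hp) hf h
  rw [hlaw, hwchar g, ENNReal.toReal_ofReal (pow_nonneg (modDelta_pos L e dV hdV dW hdW p).le _)]
  -- `modDelta p = modDelta (Λ g)` (`n₀ ∈ N_Δ(𝔸)` has modulus `1`)
  have hmodp : modDelta L e dV hdV dW hdW p = modDelta L e dV hdV dW hdW (Λ g) := by
    rw [hpm, modDelta_mul L e dV hdV dW hdW (isSiegelDelta_levi_apply L e dV hdV dW hdW Λ hΛ g) (isSiegelDelta_of_mem_unipDelta L e dV hdV dW hdW hn₀),
      modDelta_eq_one_of_mem_unipDelta L e dV hdV dW hdW hn₀, mul_one]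
  have hchar' : siegelDeltaCharacter L e dV hdV dW hdW χ' (-s) p =
      ((chiDet L e dV hdV dW hdW χ' (Λ g) : ℂˣ) : ℂ) * ((modDelta L e dV hdV dW hdW (Λ g) : ℂ) ^ (2 * (-s) + (n : ℂ))) := by
    rw [hpm]; exact siegelDeltaCharacter_levi_mul_unip L e dV hdV dW hdW Λ hΛ χ' s g hn₀
  rw [hchar', hmodp, ← ofReal_pow_mul_cpow_neg (modDelta_pos L e dV hdV dW hdW (Λ g)) s n]
  ring

/-! ## §3 The family form: the binder `heqv` of ★ `growth_of_equivariance` -/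

include hΛ in
/-- **EQUIVARIANCE OF THE BIG-CELL FAMILY ON THE CONVERGENCE HALF-PLANE** — the binder `heqv` of ★ `K2LiuBigCellGrowthOfEquivariance.growth_of_equivariance_of_pointRepr`:
for a family of Siegel sections `f s ∈ I(s, χ)`, a scalar `a : ℂ → ℂ` (the pole-clearing ∕ normalising factor of the package) and every `s` (with (MOD), (WCHAR) as in
`isSiegelDeltaSection_intertwiningDelta`), the family `E s h := a s · M (f s) (h)` satisfies `E s (p * h) = ω s p · E s h` on `P := {p | IsSiegelDelta p}` with
`ω s p := χ′(det_Δ p) · (modDelta p : ℂ)^(n − 2s)` — whose bound `hω` is ★ `K2LiuModDeltaHeightComparison.exists_character_bound` (`κ = n`).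
[cite: MoeglinWaldspurger1995, II.1.6, IV.1.9] [cite: HarrisKudlaSweet1996, §1 (1.15)] -/
theorem intertwiningDelta_family_equivariant (hdV0 : ∀ i, dV i ≠ 0) (hdW0 : ∀ i, dW i ≠ 0)
    [MeasurableSpace (unipDelta L e dV hdV dW hdW)] [BorelSpace (unipDelta L e dV hdV dW hdW)]
    (νN : Measure (unipDelta L e dV hdV dW hdW)) [νN.IsMulLeftInvariant]
    (hmod : ∀ (p : HA L e dV hdV dW hdW) (hp : IsSiegelDelta L e dV hdV dW hdW p),
      Measure.map (fun u : unipDelta L e dV hdV dW hdW =>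
        (⟨p⁻¹ * (u : HA L e dV hdV dW hdW) * p, conj_mem_unipDelta L e dV hdV dW hdW hp u.2⟩ : unipDelta L e dV hdV dW hdW)) νN =
        ENNReal.ofReal (modDelta L e dV hdV dW hdW p ^ (2 * n)) • νN)
    (χ χ' : HeckeCharacter L) {c : ℝ}
    (hwchar : ∀ s : ℂ, c < s.re → ∀ g : GL (Fin n) (AdeleRing (𝓞 L) L),
      siegelDeltaCharacter L e dV hdV dW hdW χ s (weylDelta L e dV hdV dW hdW * Λ g * weylDelta L e dV hdV dW hdW) =
        ((chiDet L e dV hdV dW hdW χ' (Λ g) : ℂˣ) : ℂ) * ((modDelta L e dV hdV dW hdW (Λ g) : ℂ) ^ (-(2 * s + (n : ℂ)))))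
    (f : ℂ → HA L e dV hdV dW hdW → ℂ) (hf : ∀ s : ℂ, IsSiegelDeltaSection L e dV hdV dW hdW χ s (f s)) (a : ℂ → ℂ) :
    ∀ s : ℂ, c < s.re → ∀ p ∈ {p : HA L e dV hdV dW hdW | IsSiegelDelta L e dV hdV dW hdW p}, ∀ h : HA L e dV hdV dW hdW,
      a s * intertwiningDelta L e dV hdV dW hdW νN (f s) (p * h) =
        (((chiDet L e dV hdV dW hdW χ' p : ℂˣ) : ℂ) * ((modDelta L e dV hdV dW hdW p : ℝ) : ℂ) ^ (((n : ℝ) : ℂ) - 2 * s)) *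
          (a s * intertwiningDelta L e dV hdV dW hdW νN (f s) h) := by
  intro s hs p hp h
  have hsec := isSiegelDeltaSection_intertwiningDelta L e dV hdV dW hdW Λ hΛ hdV0 hdW0 νN hmod χ χ' s (hwchar s hs) (hf s) p hp h
  rw [hsec]
  unfold siegelDeltaCharacter
  have hexp : (2 * (-s) + (n : ℂ)) = (((n : ℝ) : ℂ) - 2 * s) := by push_cast; ring
  rw [hexp]
  ring

end Summit.HodgeConjecture.HodgeConjecture.Cruxes.HLiu418.K2LiuIntertwiningDeltaEquivariance

end
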